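import Mathlib
import Summits.AtomisticToContinuum.HydrodynamicLimit.Theorems.OneSphereInfluenceStaticScoreResponseDisintegration
import Summits.AtomisticToContinuum.HydrodynamicLimit.Theorems.OneSphereInfluenceStaticScoreResponseGaussPi
import Summits.AtomisticToContinuum.HydrodynamicLimit.Theorems.OneSphereInfluenceMeanVarianceL2ScoreCore
import Literature.MathematicalPhysics.KineticTheory.HardSphereEulerProofs
import HarnessLib

/-!
# `StaticScoreResponse` (support item stmt-AtomisticToContinuum-12269): covariances with the score,
# reduced to the configurational Gibbs measure

For the local Gibbs measure `P_N = localGibbsMeasure σ a₁ u₁ θ₁ N` (continuous profiles, `a₁, θ₁ > 0`,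
`σ ≤ 1/2`), an additive observable `S(z) = ∑ᵢ (g(xᵢ) + s(xᵢ, vᵢ))` whose velocity part is, in
Gaussian coordinates `v = u₁(x) + √θ₁(x) w`, a quadratic observable `α_H(x) + ⟪w, β_H(x)⟫ + c_H(x)‖w‖²`
of Maxwellian mean zero (`α_H + 3c_H = 0` — the velocity score), and a one-particle field
`Y(z) = n⁻¹ ∑ⱼ χ(xⱼ) φ(vⱼ)` with `φ(u₁ + √θ₁ w) = α_P + ⟪w, β_P⟫ + c_P‖w‖²`:

`Cov_{P_N}(S, Y) = n⁻¹ [∫ (∑g)(∑χψ̄) dμ_pos - ∫ ∑g dμ_pos ∫ ∑χψ̄ dμ_pos] + ∫ n⁻¹ ∑ᵢ χ(xᵢ) m(xᵢ) dμ_pos`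

(`covariance_score_observable`), where `μ_pos = posGibbsMeasure a₁ ε_N (N+1)`, `ψ̄ = α_P + 3c_P` is
the Maxwellian mean of `φ` and `m = ⟪β_H, β_P⟫ + c_P(3α_H + 15c_H)` the Maxwellian mean of `s·φ`:
a configurational covariance of two additive position observables plus the mean of a third.
Gaussian integration (`GaussPi`) over the disintegration (`Disintegration`); folklore, no
definitions, no named facts.
-/

noncomputable section

namespace Summit.AtomisticToContinuum.HydrodynamicLimit.Theorems

open MeasureTheory ProbabilityTheory Set Filter Topology Finset
  Literature.Analysis.FluidPDE Literature.MathematicalPhysics.KineticTheory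
open scoped ENNReal NNReal InnerProductSpace

/-! ### Small tools -/

/-- A uniform quadratic bound for a quadratic observable with continuous coefficients on `𝕋³`.
[folklore] -/
theorem exists_bound_quad {αq cq : T3 → ℝ} {βq : T3 → V3} (hα : Continuous αq) (hβ : Continuous βq)
    (hc : Continuous cq) :
    ∃ K : ℝ, 0 ≤ K ∧ ∀ x (w : V3), |αq x + ⟪w, βq x⟫_ℝ + cq x * ‖w‖ ^ 2| ≤ K * (1 + ‖w‖ ^ 2) := by
  obtain ⟨A, hA0, hA⟩ := exists_forall_abs_le_of_continuous hα
  obtain ⟨B, hB0, hB⟩ := exists_forall_abs_le_of_continuous hβ.norm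
  obtain ⟨C, hC0, hC⟩ := exists_forall_abs_le_of_continuous hc
  refine ⟨A + B + C, by positivity, fun x w => (abs_quad_le _ _ _ _).trans ?_⟩
  have hBx : ‖βq x‖ ≤ B := (le_abs_self _).trans (hB x)
  exact mul_le_mul_of_nonneg_right (by linarith [hA x, hC x]) (by positivity)

/-- A continuous function of the positions is integrable under the configurational Gibbs measure.
[folklore] -/
theorem integrable_posGibbsMeasure_of_continuous {a₁ : T3 → ℝ} (ha : Continuous a₁) (ha0 : ∀ x, 0 ≤ a₁ x)
    (ε : ℝ) (n : ℕ) {F : (Fin n → T3) → ℝ} (hF : Continuous F) : Integrable F (posGibbsMeasure a₁ ε n) := by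
  haveI := isFiniteMeasure_posGibbsMeasure ha ha0 ε n
  obtain ⟨C, hC⟩ := (isCompact_range (continuous_abs.comp hF)).bddAbove
  exact Integrable.mono' (integrable_const C) hF.aestronglyMeasurable
    (ae_of_all _ fun x => by rw [Real.norm_eq_abs]; exact hC ⟨x, rfl⟩)

/-! ### The Gaussian inner integrals -/

section Inner

variable {n : ℕ} (x : Fin n → T3) (g χ αH cH αP cP : T3 → ℝ) (βH βP : T3 → V3) (r : ℝ)

/-- Inner integral of the score: the velocity part has Maxwellian mean zero. [folklore] -/
theorem inner_integral_score (hH0 : ∀ y, αH y + 3 * cH y = 0) :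
    ∫ w, ∑ i, (g (x i) + (αH (x i) + ⟪w i, βH (x i)⟫_ℝ + cH (x i) * ‖w i‖ ^ 2))
        ∂Measure.pi (fun _ : Fin n => stdGaussian V3) = ∑ i, g (x i) := by
  have h : ∀ w : Fin n → V3, ∑ i, (g (x i) + (αH (x i) + ⟪w i, βH (x i)⟫_ℝ + cH (x i) * ‖w i‖ ^ 2)) =
      ∑ i, ((g (x i) + αH (x i)) + ⟪w i, βH (x i)⟫_ℝ + cH (x i) * ‖w i‖ ^ 2) :=
    fun w => Finset.sum_congr rfl fun i _ => by ring
  simp_rw [h]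
  rw [integral_sum_comp_eval_gaussPi (F := fun i y => (g (x i) + αH (x i)) + ⟪y, βH (x i)⟫_ℝ + cH (x i) * ‖y‖ ^ 2)
    fun i => integrable_quad _ _ _]
  refine Finset.sum_congr rfl fun i _ => ?_
  rw [integral_quad]
  linarith [hH0 (x i)]

/-- Inner integral of the field: `E φ(u₁ + √θ₁ w) = α_P + 3c_P`. [folklore] -/
theorem inner_integral_field :
    ∫ w, ∑ j, (r * χ (x j)) * (αP (x j) + ⟪w j, βP (x j)⟫_ℝ + cP (x j) * ‖w j‖ ^ 2)
        ∂Measure.pi (fun _ : Fin n => stdGaussian V3) = ∑ j, (r * χ (x j)) * (αP (x j) + 3 * cP (x j)) := by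
  rw [integral_sum_comp_eval_gaussPi (F := fun j y => (r * χ (x j)) * (αP (x j) + ⟪y, βP (x j)⟫_ℝ + cP (x j) * ‖y‖ ^ 2))
    fun j => (integrable_quad _ _ _).const_mul _]
  refine Finset.sum_congr rfl fun j _ => ?_
  rw [integral_const_mul, integral_quad]

/-- Inner integral of score times field: the cross terms vanish and the diagonal gives
`m = ⟪β_H, β_P⟫ + c_P (3α_H + 15c_H)`. [folklore] -/
theorem inner_integral_score_mul_field (hH0 : ∀ y, αH y + 3 * cH y = 0) :
    ∫ w, (∑ i, (g (x i) + (αH (x i) + ⟪w i, βH (x i)⟫_ℝ + cH (x i) * ‖w i‖ ^ 2))) *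
        ∑ j, (r * χ (x j)) * (αP (x j) + ⟪w j, βP (x j)⟫_ℝ + cP (x j) * ‖w j‖ ^ 2)
        ∂Measure.pi (fun _ : Fin n => stdGaussian V3) =
      (∑ i, g (x i)) * (∑ j, (r * χ (x j)) * (αP (x j) + 3 * cP (x j))) +
        ∑ i, (r * χ (x i)) * (⟪βH (x i), βP (x i)⟫_ℝ + cP (x i) * (3 * αH (x i) + 15 * cH (x i))) := by
  have hHm : ∀ i, Measurable fun y : V3 => αH (x i) + ⟪y, βH (x i)⟫_ℝ + cH (x i) * ‖y‖ ^ 2 := fun i => by fun_prop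
  have hPm : ∀ j, Measurable fun y : V3 => αP (x j) + ⟪y, βP (x j)⟫_ℝ + cP (x j) * ‖y‖ ^ 2 := fun j => by fun_prop
  have hH0' : ∀ i, ∫ y, (αH (x i) + ⟪y, βH (x i)⟫_ℝ + cH (x i) * ‖y‖ ^ 2) ∂stdGaussian V3 = 0 := fun i => by
    rw [integral_quad]; exact hH0 (x i)
  rw [integral_sum_mul_sum_gaussPi (H := fun i y => αH (x i) + ⟪y, βH (x i)⟫_ℝ + cH (x i) * ‖y‖ ^ 2)
    (P := fun j y => αP (x j) + ⟪y, βP (x j)⟫_ℝ + cP (x j) * ‖y‖ ^ 2) (fun i => g (x i)) (fun j => r * χ (x j))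
    hHm hPm (fun i => integrable_quad _ _ _) (fun j => integrable_quad _ _ _)
    (fun i => integrable_quad_mul_quad _ _ _ _ _ _) hH0']
  congr 1
  · refine congrArg _ (Finset.sum_congr rfl fun j _ => ?_)
    rw [integral_quad]
  · refine Finset.sum_congr rfl fun i _ => ?_
    rw [integral_quad_mul_quad, hH0 (x i), mul_zero, zero_add]

end Inner

/-! ### The reduction -/

variable {a₁ θ₁ g χ αH cH αP cP : T3 → ℝ} {u₁ βH βP : T3 → V3} {sv : T3 → V3 → ℝ} {φ : V3 → ℝ}
  {σ : ℝ} {N : ℕ}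

/-- **Covariance with the score, reduced to the configurational Gibbs measure.** See the module
docstring. [folklore] -/
theorem covariance_score_observable (ha : Continuous a₁) (hθ : Continuous θ₁) (hu : Continuous u₁)
    (ha0 : ∀ x, 0 < a₁ x) (hθ0 : ∀ x, 0 < θ₁ x) (hσ2 : σ ≤ 1 / 2) (hg : Continuous g) (hχ : Continuous χ)
    (hsv : Measurable fun p : T3 × V3 => sv p.1 p.2) (hφ : Measurable φ)
    (hαH : Continuous αH) (hβH : Continuous βH) (hcH : Continuous cH)
    (hαP : Continuous αP) (hβP : Continuous βP) (hcP : Continuous cP)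
    (hsvq : ∀ x w, sv x (u₁ x + Real.sqrt (θ₁ x) • w) = αH x + ⟪w, βH x⟫_ℝ + cH x * ‖w‖ ^ 2)
    (hφq : ∀ x w, φ (u₁ x + Real.sqrt (θ₁ x) • w) = αP x + ⟪w, βP x⟫_ℝ + cP x * ‖w‖ ^ 2)
    (hH0 : ∀ x, αH x + 3 * cH x = 0) :
    cov[fun z : Config (N + 1) (Fin 3) T3 => ∑ i, (g (z i).1 + sv (z i).1 (z i).2),
        fun z => (((N + 1 : ℕ) : ℝ))⁻¹ * ∑ i, χ (z i).1 * φ (z i).2; localGibbsMeasure σ a₁ u₁ θ₁ N] =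
      (((N + 1 : ℕ) : ℝ))⁻¹ * ((∫ x, (∑ i, g (x i)) * ∑ i, χ (x i) * (αP (x i) + 3 * cP (x i))
            ∂posGibbsMeasure a₁ (hsDiameter σ N) (N + 1)) -
          (∫ x, ∑ i, g (x i) ∂posGibbsMeasure a₁ (hsDiameter σ N) (N + 1)) *
            ∫ x, ∑ i, χ (x i) * (αP (x i) + 3 * cP (x i)) ∂posGibbsMeasure a₁ (hsDiameter σ N) (N + 1)) +
        ∫ x, (((N + 1 : ℕ) : ℝ))⁻¹ * ∑ i, χ (x i) * (⟪βH (x i), βP (x i)⟫_ℝ + cP (x i) * (3 * αH (x i) + 15 * cH (x i)))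
          ∂posGibbsMeasure a₁ (hsDiameter σ N) (N + 1) := by
  classical
  have ha0' : ∀ x, 0 ≤ a₁ x := fun x => (ha0 x).le
  set n := N + 1 with hn
  set pos := posGibbsMeasure a₁ (hsDiameter σ N) n with hpos
  set Γ : Measure (Fin n → V3) := Measure.pi fun _ : Fin n => stdGaussian V3 with hΓ
  set r : ℝ := (((n : ℕ) : ℝ))⁻¹ with hr
  haveI : IsProbabilityMeasure pos := isProbabilityMeasure_posGibbsMeasure ha ha0 hσ2 N
  haveI : IsProbabilityMeasure (localGibbsMeasure σ a₁ u₁ θ₁ N) :=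
    isProbabilityMeasure_localGibbsMeasure ha hθ hu ha0 hθ0 hσ2 N
  -- Gaussian coordinates
  set T : (Fin n → T3) × (Fin n → V3) → Config n (Fin 3) T3 :=
    fun p => zipConfig (p.1, fun i => u₁ (p.1 i) + Real.sqrt (θ₁ (p.1 i)) • p.2 i) with hT
  have hTm : Measurable T := measurable_gaussParam hθ hu n
  have hμ : localGibbsMeasure σ a₁ u₁ θ₁ N = (pos.prod Γ).map T :=
    localGibbsMeasure_eq_map ha hθ hu ha0' hθ0 σ N
  -- the observables
  set S : Config n (Fin 3) T3 → ℝ := fun z => ∑ i, (g (z i).1 + sv (z i).1 (z i).2) with hS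
  set Y : Config n (Fin 3) T3 → ℝ := fun z => r * ∑ i, χ (z i).1 * φ (z i).2 with hY
  have hSm : Measurable S := by
    refine Finset.measurable_sum _ fun i _ => ?_
    have h1 : Measurable fun z : Config n (Fin 3) T3 => sv (z i).1 (z i).2 := hsv.comp (measurable_pi_apply i)
    exact (hg.measurable.comp (measurable_fst.comp (measurable_pi_apply i))).add h1
  have hYm : Measurable Y := by
    refine (Finset.measurable_sum _ fun i _ => ?_).const_mul r
    exact (hχ.measurable.comp (measurable_fst.comp (measurable_pi_apply i))).mul
      (hφ.comp (measurable_snd.comp (measurable_pi_apply i)))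
  -- their Gaussian-coordinate forms
  have hST : ∀ (x : Fin n → T3) (w : Fin n → V3), S (T (x, w)) =
      ∑ i, (g (x i) + (αH (x i) + ⟪w i, βH (x i)⟫_ℝ + cH (x i) * ‖w i‖ ^ 2)) := by
    intro x w
    simp only [hS, hT, zipConfig_apply, hsvq]
  have hYT : ∀ (x : Fin n → T3) (w : Fin n → V3), Y (T (x, w)) =
      ∑ j, (r * χ (x j)) * (αP (x j) + ⟪w j, βP (x j)⟫_ℝ + cP (x j) * ‖w j‖ ^ 2) := by
    intro x w
    simp only [hY, hT, zipConfig_apply, hφq, Finset.mul_sum]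
    exact Finset.sum_congr rfl fun j _ => by ring
  -- uniform bounds
  obtain ⟨KH, hKH0, hKH⟩ := exists_bound_quad hαH hβH hcH
  obtain ⟨KP, hKP0, hKP⟩ := exists_bound_quad hαP hβP hcP
  obtain ⟨G, hG0, hG⟩ := exists_forall_abs_le_of_continuous hg
  obtain ⟨X, hX0, hX⟩ := exists_forall_abs_le_of_continuous hχ
  have hr0 : 0 ≤ r := by positivity
  have hbS : ∀ (y : T3) (w : V3), |g y + (αH y + ⟪w, βH y⟫_ℝ + cH y * ‖w‖ ^ 2)| ≤ (G + KH) * (1 + ‖w‖ ^ 2) := by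
    intro y w
    have ht : (0 : ℝ) ≤ ‖w‖ ^ 2 := by positivity
    calc |g y + (αH y + ⟪w, βH y⟫_ℝ + cH y * ‖w‖ ^ 2)| ≤ |g y| + |αH y + ⟪w, βH y⟫_ℝ + cH y * ‖w‖ ^ 2| := abs_add_le _ _
      _ ≤ G + KH * (1 + ‖w‖ ^ 2) := add_le_add (hG y) (hKH y w)
      _ ≤ (G + KH) * (1 + ‖w‖ ^ 2) := by nlinarith [mul_nonneg hG0 ht]
  have hbY : ∀ (y : T3) (w : V3), |(r * χ y) * (αP y + ⟪w, βP y⟫_ℝ + cP y * ‖w‖ ^ 2)| ≤ (r * X * KP) * (1 + ‖w‖ ^ 2) := by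
    intro y w
    rw [abs_mul, abs_mul, abs_of_nonneg hr0]
    calc r * |χ y| * |αP y + ⟪w, βP y⟫_ℝ + cP y * ‖w‖ ^ 2| ≤ r * X * (KP * (1 + ‖w‖ ^ 2)) :=
          mul_le_mul (mul_le_mul_of_nonneg_left (hX y) hr0) (hKP y w) (abs_nonneg _) (by positivity)
      _ = (r * X * KP) * (1 + ‖w‖ ^ 2) := by ring
  have hone : ∀ w : V3, 1 + ‖w‖ ^ 2 ≤ (1 + ‖w‖ ^ 2) * (1 + ‖w‖ ^ 2) := fun w => by nlinarith [sq_nonneg ‖w‖]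
  -- integrability in Gaussian coordinates
  have hSTi : Integrable (fun p => S (T p)) (pos.prod Γ) := by
    have h : (fun p : (Fin n → T3) × (Fin n → V3) => S (T p)) =
        fun p => ∑ i, (g (p.1 i) + (αH (p.1 i) + ⟪p.2 i, βH (p.1 i)⟫_ℝ + cH (p.1 i) * ‖p.2 i‖ ^ 2)) :=
      funext fun p => hST p.1 p.2
    rw [h]
    refine integrable_finsetSum _ fun i _ => integrable_prod_gaussPi_of_le pos ?_ i i (C := G + KH) fun p => ?_
    · exact (by fun_prop : Continuous fun p : (Fin n → T3) × (Fin n → V3) =>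
        g (p.1 i) + (αH (p.1 i) + ⟪p.2 i, βH (p.1 i)⟫_ℝ + cH (p.1 i) * ‖p.2 i‖ ^ 2)).aestronglyMeasurable
    · exact (hbS (p.1 i) (p.2 i)).trans (mul_le_mul_of_nonneg_left (hone (p.2 i)) (by positivity))
  have hYTi : Integrable (fun p => Y (T p)) (pos.prod Γ) := by
    have h : (fun p : (Fin n → T3) × (Fin n → V3) => Y (T p)) =
        fun p => ∑ j, (r * χ (p.1 j)) * (αP (p.1 j) + ⟪p.2 j, βP (p.1 j)⟫_ℝ + cP (p.1 j) * ‖p.2 j‖ ^ 2) :=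
      funext fun p => hYT p.1 p.2
    rw [h]
    refine integrable_finsetSum _ fun j _ => integrable_prod_gaussPi_of_le pos ?_ j j (C := r * X * KP) fun p => ?_
    · exact (by fun_prop : Continuous fun p : (Fin n → T3) × (Fin n → V3) =>
        (r * χ (p.1 j)) * (αP (p.1 j) + ⟪p.2 j, βP (p.1 j)⟫_ℝ + cP (p.1 j) * ‖p.2 j‖ ^ 2)).aestronglyMeasurable
    · exact (hbY (p.1 j) (p.2 j)).trans (mul_le_mul_of_nonneg_left (hone (p.2 j)) (by positivity))
  have hSYTi : Integrable (fun p => S (T p) * Y (T p)) (pos.prod Γ) := by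
    have h : (fun p : (Fin n → T3) × (Fin n → V3) => S (T p) * Y (T p)) =
        fun p => ∑ i, ∑ j, (g (p.1 i) + (αH (p.1 i) + ⟪p.2 i, βH (p.1 i)⟫_ℝ + cH (p.1 i) * ‖p.2 i‖ ^ 2)) *
          ((r * χ (p.1 j)) * (αP (p.1 j) + ⟪p.2 j, βP (p.1 j)⟫_ℝ + cP (p.1 j) * ‖p.2 j‖ ^ 2)) := by
      funext p
      rw [show S (T p) = S (T (p.1, p.2)) from rfl, show Y (T p) = Y (T (p.1, p.2)) from rfl, hST, hYT,
        Finset.sum_mul_sum]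
    rw [h]
    refine integrable_finsetSum _ fun i _ => integrable_finsetSum _ fun j _ =>
      integrable_prod_gaussPi_of_le pos ?_ i j (C := (G + KH) * (r * X * KP)) fun p => ?_
    · exact (by fun_prop : Continuous fun p : (Fin n → T3) × (Fin n → V3) =>
        (g (p.1 i) + (αH (p.1 i) + ⟪p.2 i, βH (p.1 i)⟫_ℝ + cH (p.1 i) * ‖p.2 i‖ ^ 2)) *
          ((r * χ (p.1 j)) * (αP (p.1 j) + ⟪p.2 j, βP (p.1 j)⟫_ℝ + cP (p.1 j) * ‖p.2 j‖ ^ 2))).aestronglyMeasurable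
    · rw [abs_mul]
      calc |g (p.1 i) + (αH (p.1 i) + ⟪p.2 i, βH (p.1 i)⟫_ℝ + cH (p.1 i) * ‖p.2 i‖ ^ 2)| *
            |(r * χ (p.1 j)) * (αP (p.1 j) + ⟪p.2 j, βP (p.1 j)⟫_ℝ + cP (p.1 j) * ‖p.2 j‖ ^ 2)|
            ≤ ((G + KH) * (1 + ‖p.2 i‖ ^ 2)) * ((r * X * KP) * (1 + ‖p.2 j‖ ^ 2)) :=
            mul_le_mul (hbS _ _) (hbY _ _) (abs_nonneg _) (by positivity)
        _ = (G + KH) * (r * X * KP) * ((1 + ‖p.2 i‖ ^ 2) * (1 + ‖p.2 j‖ ^ 2)) := by ring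
  -- integrability under the local Gibbs measure
  have toP : ∀ {F : Config n (Fin 3) T3 → ℝ}, Measurable F → Integrable (fun p => F (T p)) (pos.prod Γ) →
      Integrable F (localGibbsMeasure σ a₁ u₁ θ₁ N) := by
    intro F hFm hFT
    rw [hμ]
    exact (integrable_map_measure hFm.aestronglyMeasurable hTm.aemeasurable).2 hFT
  have hSi : Integrable S (localGibbsMeasure σ a₁ u₁ θ₁ N) := toP hSm hSTi
  have hYi : Integrable Y (localGibbsMeasure σ a₁ u₁ θ₁ N) := toP hYm hYTi
  have hSYi : Integrable (fun z => S z * Y z) (localGibbsMeasure σ a₁ u₁ θ₁ N) := toP (hSm.mul hYm) hSYTi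
  -- the three expectations
  have hES : ∫ z, S z ∂localGibbsMeasure σ a₁ u₁ θ₁ N = ∫ x, ∑ i, g (x i) ∂pos := by
    rw [integral_localGibbsMeasure_eq ha hθ hu ha0' hθ0 σ N hSi]
    refine integral_congr_ae (ae_of_all _ fun x => ?_)
    change ∫ w, S (T (x, w)) ∂Γ = _
    simp_rw [hST]
    exact inner_integral_score x g αH cH βH hH0
  have hEY : ∫ z, Y z ∂localGibbsMeasure σ a₁ u₁ θ₁ N = ∫ x, ∑ j, (r * χ (x j)) * (αP (x j) + 3 * cP (x j)) ∂pos := by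
    rw [integral_localGibbsMeasure_eq ha hθ hu ha0' hθ0 σ N hYi]
    refine integral_congr_ae (ae_of_all _ fun x => ?_)
    change ∫ w, Y (T (x, w)) ∂Γ = _
    simp_rw [hYT]
    exact inner_integral_field x χ αP cP βP r
  have hESY : ∫ z, S z * Y z ∂localGibbsMeasure σ a₁ u₁ θ₁ N =
      ∫ x, ((∑ i, g (x i)) * (∑ j, (r * χ (x j)) * (αP (x j) + 3 * cP (x j))) +
        ∑ i, (r * χ (x i)) * (⟪βH (x i), βP (x i)⟫_ℝ + cP (x i) * (3 * αH (x i) + 15 * cH (x i)))) ∂pos := by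
    rw [integral_localGibbsMeasure_eq ha hθ hu ha0' hθ0 σ N hSYi]
    refine integral_congr_ae (ae_of_all _ fun x => ?_)
    change ∫ w, S (T (x, w)) * Y (T (x, w)) ∂Γ = _
    simp_rw [hST, hYT]
    exact inner_integral_score_mul_field x g χ αH cH αP cP βH βP r hH0
  -- assemble
  rw [OneSphereInfluenceMeanVarianceL2.covariance_eq_integral_mul_sub hSi hYi hSYi, hES, hEY, hESY]
  have hB : ∀ x : Fin n → T3, ∑ j, (r * χ (x j)) * (αP (x j) + 3 * cP (x j)) =
      r * ∑ j, χ (x j) * (αP (x j) + 3 * cP (x j)) := fun x => by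
    rw [Finset.mul_sum]; exact Finset.sum_congr rfl fun j _ => by ring
  have hC : ∀ x : Fin n → T3, ∑ i, (r * χ (x i)) * (⟪βH (x i), βP (x i)⟫_ℝ + cP (x i) * (3 * αH (x i) + 15 * cH (x i))) =
      r * ∑ i, χ (x i) * (⟪βH (x i), βP (x i)⟫_ℝ + cP (x i) * (3 * αH (x i) + 15 * cH (x i))) := fun x => by
    rw [Finset.mul_sum]; exact Finset.sum_congr rfl fun i _ => by ring
  simp_rw [hB, hC]
  have hAB : ∀ x : Fin n → T3, (∑ i, g (x i)) * (r * ∑ j, χ (x j) * (αP (x j) + 3 * cP (x j))) =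
      r * ((∑ i, g (x i)) * ∑ j, χ (x j) * (αP (x j) + 3 * cP (x j))) := fun x => by ring
  simp_rw [hAB]
  have i1 : Integrable (fun x : Fin n → T3 => r * ((∑ i, g (x i)) * ∑ j, χ (x j) * (αP (x j) + 3 * cP (x j)))) pos :=
    integrable_posGibbsMeasure_of_continuous ha ha0' _ n (by fun_prop)
  have i2 : Integrable (fun x : Fin n → T3 =>
      r * ∑ i, χ (x i) * (⟪βH (x i), βP (x i)⟫_ℝ + cP (x i) * (3 * αH (x i) + 15 * cH (x i)))) pos :=
    integrable_posGibbsMeasure_of_continuous ha ha0' _ n (by fun_prop)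
  rw [integral_add i1 i2]
  simp only [integral_const_mul]
  ring

end Summit.AtomisticToContinuum.HydrodynamicLimit.Theorems

end
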